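import Summits.QuantumFields.YangMills.Theorems.BalabanUVNodesN15SiteScalarLayerDressedSized
import HarnessLib

/-!
# Route «BalabanUVNodes», cluster K4 «SpineRates» — node N15 = NE2: THE SITE LAYER WITH THE BACKGROUND LIVE IN THE TwoGrid ENTRY CURRENCY, XXI — THE COLOURED SITE SOCKET:
# `NE2PlusSite` FOR EVERY COLOUR ENTRY OF THE PERTURBED COLOURED SITE KERNEL `((Q′G′²Q′*) ⊗ 1_ι + P(U))⁻¹` from the coloured perturbation's three letters alone —
# the socket the non-abelian site layer (`G′ ⊗ 1_𝔤` dressed by an `ad A′`-species, colours MIXED by the dressing) needs; part II ∕ part XI §1's engine on the index `Idx M × ι`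

Cell `pub-ymgap`, WIDTH SEAT `pub-ymgap-dag-n15-w1` (generation 3; director-ym №197 ∕ HUMAN RULING D-0149; chair R455 (A) ∕ R461; plan g83 `W-SEAT-START-LIST.md` v11 §n15;
g2's located leftover (α) «the non-abelian upgrade: coloured site layer `G′ ⊗ 1_𝔤` with `ad A′` species», INBOX l.30136 — step 1 of 4).  `bears_on: R4∕N15 · K3⁷
SpineGivenEndpointR13SepCoPH (stmt-QuantumFields-20544)`.  Filed `--supports stmt-QuantumFields-20544 --as helper` — COUNT-NEUTRAL.  Three plumbing `def`s (`colDiag`, `siteExC`,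
`cSiteExOn`), the rest theorems; 0 `sorry`.  Imports BY NAME this seat's part XI `…N15SiteScalarLayerDressedSized` (through it part II `siteEx`, `siteForm_letters_family`, the ENGINE
`abs_inv_add_sub_inv_add_le_of_coercive`, part II-S `sSiteExOn`, G1 `etaRateIneqSite_opGeo_unit`, lit `Coercive`, `qggqRe`, `tdist`, `torusSum_le`); nothing in the tree is modified.

WHY.  Every site layer in the tree (g0's parts II∕II-S, part XI, dag-n15-c G1) inverts a SCALAR site form on the coarse site index `Idx M`: the propagator it dresses is the
scalar `G′`, and a background can enter only through an ABELIAN component (parts X∕XII∕XV∕XIX: `φ ∘ A′`).  Bałaban's scalar fields carry colour ([Balaban1985BackgroundPropagators]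
(3.1)–(3.5) p.390: `R(U)` a unitary representation; (3.52) p.400: `V′₁(A)` built from `R′(A)`), so the honest `U ≡ 1` site propagator is `G′ ⊗ 1_ι` and the first-order species
mixes colours — its dressed site form lives on `Idx M × ι` and does NOT factor.  THIS FILE supplies the socket on that index: the unperturbed matrix is the colour-diagonal lift
`colDiag ι (Q′G′²Q′*)` (coercive with the SAME constant, entries and η-rate letters inherited), the perturbation `P(U)` is an ARBITRARY matrix on `Idx M × ι` with part II's three
letters (decay in the site distance, uniform in colour), and part II's engine — generic in the index and its distance — runs with `ρ((p,i),(q,j)) = tdist(p,q)` (row sums pick up the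
factor `|ι|`).  The conclusion is `NE2PlusSite` for the kernel family reading ANY fixed colour entry `(c i, c′ i)` of `(colDiag(Q′G′²Q′*) + P)⁻¹′ − (… + P)⁻¹`, size LIVE (`M·α₀ ≤ a₀`).

CONTENTS.  §1 `colDiag` (+ `_apply`, `_sub`, `abs_colDiag_apply_le`, `colDiag_decay`, ★ `coercive_colDiag`, `colRowSum_le`); §2 `siteExC` (`siteExC_eq`); §3 `cSiteExOn` (+ `_ker`), ★★★
`ne2PlusSite_cSiteExOn_of_sizedLetters` (part XI §1 on `Idx M × ι`).

HONEST FRAMING.  Count-neutral, species-independent SOCKET; no new estimate (the engine, the coercivity and the `U ≡ 1` letters are the tree's; the colour lift is bookkeeping).  The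
coloured `U ≡ 1` site form IS `(Q′G′²Q′*) ⊗ 1` (genuine); what is read is ONE colour entry of the inverse per kernel (the tree's `B9.SiteKernel` is scalar-valued) — all entries
uniformly.  NOT [B9] Thm 3.2 at a general (3.35)-regular `U` (NE2⁺ NOT PRINTED as an η-rate); Node 00's [B9] layers of record are residual — **N15 is NOT discharged** (typed 28∕28 ·
discharged 5∕27 of record unchanged); K3⁷ OPEN, its N15 pin untouched; one finite four-torus programme at fixed `ε` — NOT ℝ⁴, NOT infinite volume, NOT OS, NOT a mass gap, NOT Clay;
R4 closes the conditional finite-𝕋⁴ rung `BalabanLadder.UV` only.  Restate-immune.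
-/

set_option autoImplicit false

noncomputable section

open scoped BigOperators Matrix
open Finset

namespace Summit.QuantumFields.YangMills.BalabanUVNodes.N15.SiteLayerBg

open Literature.MathematicalPhysics.QuantumFieldTheory.Balaban1983to89
open Literature.MathematicalPhysics.QuantumFieldTheory.Balaban1983to89.QGQInverse (Coercive)
open Literature.MathematicalPhysics.QuantumFieldTheory.King1986 (exp_decay_mono aK aK_pos)
open Literature.MathematicalPhysics.QuantumFieldTheory.King1986.Torus (tdistT)
open Literature.MathematicalPhysics.QuantumFieldTheory.Balaban1983to89.T4EtaRate (PairedInstance EtaPairing NE2PlusSite EtaRateIneqSite)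
open Literature.MathematicalPhysics.QuantumFieldTheory.Balaban1983to89.T4EtaRateDefect (rateWeight)
open Literature.MathematicalPhysics.QuantumFieldTheory.Balaban1983to89.B5Prop11Plancherel (Tor fine)
open Literature.MathematicalPhysics.QuantumFieldTheory.Balaban1983to89.B4Sect5Torus (tdist tdist_nonneg tdist_symm tdist_triangle tdist_self torusSum_le)
open Literature.MathematicalPhysics.QuantumFieldTheory.Balaban1983to89.B4Sect5Proof (latticeConst latticeConst_nonneg)
open Literature.MathematicalPhysics.QuantumFieldTheory.Balaban1983to89.B5QGGQ145Bounds (Idx kerRe qggqRe)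
open Literature.MathematicalPhysics.QuantumFieldTheory.Balaban1983to89.B5PBridgeProjection (torIdx)
open Summit.QuantumFields.YangMills.BalabanUVNodes.N15.OperatorReadout (opGeo)
open Summit.QuantumFields.YangMills.BalabanUVNodes.N15.VectorPiece (unitTorusGeoS)
open Summit.QuantumFields.YangMills.BalabanUVNodes.N15.TwoGrid (tdistT_eq_tdist_torIdx)
open Summit.QuantumFields.YangMills.BalabanUVNodes.N15.GenuineSite (etaRateIneqSite_opGeo_unit)

variable {d : ℕ} {L : ℕ} [NeZero L]

/-! ## §1 The colour-diagonal lift of a site matrix: entries, coercivity, row sums -/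

section ColDiag

variable {S : Type} (ι : Type) [DecidableEq ι]

/-- THE COLOUR-DIAGONAL LIFT `A ⊗ 1_ι` of a site matrix `A` to the coloured index `S × ι`: `(A ⊗ 1)((p,i),(q,j)) = [i = j]·A(p,q)`. [folklore] -/
def colDiag (A : Matrix S S ℝ) : Matrix (S × ι) (S × ι) ℝ := fun p q => if p.2 = q.2 then A p.1 q.1 else 0

/-- Unfolding. [folklore] -/
theorem colDiag_apply (A : Matrix S S ℝ) (p q : S × ι) : colDiag ι A p q = if p.2 = q.2 then A p.1 q.1 else 0 := rfl

/-- The lift is additive: differences. [folklore] -/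
theorem colDiag_sub (A B : Matrix S S ℝ) : colDiag ι (A - B) = colDiag ι A - colDiag ι B := by
  ext p q
  simp only [colDiag_apply, Matrix.sub_apply]
  split_ifs <;> simp

/-- Entries of the lift are entries of `A` or zero. [folklore] -/
theorem abs_colDiag_apply_le (A : Matrix S S ℝ) (p q : S × ι) : |colDiag ι A p q| ≤ |A p.1 q.1| := by
  rw [colDiag_apply]
  split_ifs
  · exact le_rfl
  · rw [abs_zero]; exact abs_nonneg _

/-- A decay letter of `A` in a site distance is a decay letter of the lift in the lifted distance. [folklore] -/
theorem colDiag_decay (ρ : S → S → ℝ) {A : Matrix S S ℝ} {C κ : ℝ} (h : ∀ p q, |A p q| ≤ C * Real.exp (-(κ * ρ p q))) (p q : S × ι) :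
    |colDiag ι A p q| ≤ C * Real.exp (-(κ * ρ p.1 q.1)) :=
  (abs_colDiag_apply_le ι A p q).trans (h p.1 q.1)

/-- The lifted quadratic form is the sum over colours of the quadratic forms of the colour slices. [folklore] -/
theorem dotProduct_colDiag_mulVec [Fintype S] [Fintype ι] (A : Matrix S S ℝ) (x : S × ι → ℝ) :
    x ⬝ᵥ (colDiag ι A *ᵥ x) = ∑ i : ι, (fun p => x (p, i)) ⬝ᵥ (A *ᵥ fun p => x (p, i)) := by
  simp only [dotProduct, Matrix.mulVec, colDiag_apply, Fintype.sum_prod_type, ite_mul, zero_mul]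
  -- left: Σ_p Σ_i x(p,i) · Σ_q Σ_j [i=j] A p q x(q,j); right: Σ_i Σ_p x(p,i) · Σ_q A p q x(q,i)
  rw [Finset.sum_comm]
  refine Finset.sum_congr rfl fun i _ => Finset.sum_congr rfl fun p _ => ?_
  congr 1
  refine Finset.sum_congr rfl fun q _ => ?_
  rw [Finset.sum_ite_eq Finset.univ i (fun j => A p q * x (q, j)), if_pos (Finset.mem_univ _)]

omit [DecidableEq ι] in
/-- The squared norm on the coloured index is the sum of the squared norms of the colour slices. [folklore] -/
theorem dotProduct_self_eq_sum_slices [Fintype S] [Fintype ι] (x : S × ι → ℝ) : x ⬝ᵥ x = ∑ i : ι, (fun p => x (p, i)) ⬝ᵥ (fun p => x (p, i)) := by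
  simp only [dotProduct, Fintype.sum_prod_type]
  rw [Finset.sum_comm]

/-- ★ **COERCIVITY IS INHERITED BY THE COLOUR-DIAGONAL LIFT, WITH THE SAME CONSTANT**: `Coercive A γ ⟹ Coercive (A ⊗ 1_ι) γ` (slice by slice). [folklore] -/
theorem coercive_colDiag [Fintype S] [DecidableEq S] [Fintype ι] {A : Matrix S S ℝ} {γ : ℝ} (h : Coercive A γ) : Coercive (colDiag ι A) γ := by
  intro x
  rw [dotProduct_colDiag_mulVec, dotProduct_self_eq_sum_slices, Finset.mul_sum]
  exact Finset.sum_le_sum fun i _ => h _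

omit [DecidableEq ι] in
/-- ROW SUMS ON THE COLOURED INDEX: `Σ_{(q,j)} e^{−a·ρ(p,q)} = |ι|·Σ_q e^{−a·ρ(p,q)}`, so a row-sum bound `V` for `ρ` gives `|ι|·V` for the lifted distance. [folklore] -/
theorem colRowSum_le [Fintype S] [Fintype ι] (ρ : S → S → ℝ) {a V : ℝ} (hV : ∀ p : S, ∑ q, Real.exp (-(a * ρ p q)) ≤ V) (p : S × ι) :
    ∑ q : S × ι, Real.exp (-(a * ρ p.1 q.1)) ≤ (Fintype.card ι : ℝ) * V := by
  rw [Fintype.sum_prod_type, Finset.sum_comm]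
  simp only [Finset.sum_const, Finset.card_univ, nsmul_eq_mul]
  exact mul_le_mul_of_nonneg_left (hV p.1) (Nat.cast_nonneg _)

end ColDiag

/-! ## §2 The perturbed coloured site kernel `((Q′G′²Q′*) ⊗ 1_ι + P)⁻¹` -/

section SiteExC

variable (ι : Type) [Fintype ι] [DecidableEq ι]

/-- THE PERTURBED COLOURED SITE KERNEL: `((Q′G′²Q′*)_{n,a} ⊗ 1_ι + P)⁻¹` on `Idx M × ι` — the coloured `U ≡ 1` site form of [B9] Thm 3.2 (genuine b05 matrix `qggqRe`, lifted colour-diagonally)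
plus an arbitrary coloured site perturbation `P` (the (3.65) words of a colour-MIXING dressing land here). [cite: Balaban1985BackgroundPropagators, Thm 3.2 (3.48) p.398 + (3.65) p.403 (shape); Balaban1984PropagatorsI, (1.45) p.26] -/
def siteExC (n : ℕ) [NeZero n] (a : ℝ) (M : Fin (d + 1) → ℕ) (P : Matrix (Idx M × ι) (Idx M × ι) ℝ) : Matrix (Idx M × ι) (Idx M × ι) ℝ :=
  (colDiag ι (qggqRe n a M) + P)⁻¹

/-- Unfolding. [folklore] -/
theorem siteExC_eq (n : ℕ) [NeZero n] (a : ℝ) (M : Fin (d + 1) → ℕ) (P : Matrix (Idx M × ι) (Idx M × ι) ℝ) :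
    siteExC ι n a M P = (colDiag ι (qggqRe n a M) + P)⁻¹ := rfl

end SiteExC

/-! ## §3 ★★★ The coloured socket: `NE2PlusSite` for every colour entry, from the coloured perturbations' three letters -/

section Socket

variable {I : Type} (ι : Type) [Fintype ι] [DecidableEq ι]
variable (Mn : I → Fin (d + 1) → ℕ) [hMn0 : ∀ i μ, NeZero (Mn i μ)] (kk mm : I → ℕ) (Msz : I → ℝ) (X : I → Type) [∀ i, Fintype (X i)] (blk : ∀ i, X i → Tor (Mn i))
  (gf : I → B9.Geometry) (Bc Bf : I → B9.Backgrounds)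

/-- ★ **THE COLOURED SITE SOCKET KERNEL, READ AT A COLOUR ENTRY** over the realised coarse carrier `opGeo (unitTorusGeoS L (k i) (M i) (M_sz i)) (X i) (blk i)`: at index `i` and the colour pair
`(c i, c′ i)`, the η-difference `((Q′G′²Q′* ⊗ 1)_{L^mL^k} + Pf i U)⁻¹((y, c i),(y′, c′ i)) − ((Q′G′²Q′* ⊗ 1)_{L^k} + Pc i (avg U))⁻¹((y, c i),(y′, c′ i))` of the perturbed coloured site
kernels of the two runs (sites through `torIdx`). [cite: Balaban1985BackgroundPropagators, Thm 3.2 (3.48) p.398 + (3.65)–(3.67) p.403 (shape of the dressed site kernel); King1986, p.664 (identity pairing of sites)] -/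
def cSiteExOn (aS : ℝ) (pair : ∀ i, EtaPairing (opGeo (unitTorusGeoS L (kk i) (Mn i) (Msz i)) (X i) (blk i)) (gf i) (Bc i) (Bf i))
    (Pf : ∀ i, (Bf i).Cfg → Matrix (Idx (Mn i) × ι) (Idx (Mn i) × ι) ℝ) (Pc : ∀ i, (Bc i).Cfg → Matrix (Idx (Mn i) × ι) (Idx (Mn i) × ι) ℝ) (c c' : I → ι) (i : I) :
    B9.SiteKernel (opGeo (unitTorusGeoS L (kk i) (Mn i) (Msz i)) (X i) (blk i)) (Bf i) :=
  ⟨fun U y y' =>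
    siteExC ι (L ^ mm i * L ^ kk i) (aK aS L (kk i + mm i)) (Mn i) (Pf i U) (torIdx (Mn i) y, c i) (torIdx (Mn i) y', c' i)
      - siteExC ι (L ^ kk i) (aK aS L (kk i)) (Mn i) (Pc i ((pair i).avg U)) (torIdx (Mn i) y, c i) (torIdx (Mn i) y', c' i)⟩

/-- Unfolding of `cSiteExOn`. [folklore] -/
theorem cSiteExOn_ker (aS : ℝ) (pair : ∀ i, EtaPairing (opGeo (unitTorusGeoS L (kk i) (Mn i) (Msz i)) (X i) (blk i)) (gf i) (Bc i) (Bf i))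
    (Pf : ∀ i, (Bf i).Cfg → Matrix (Idx (Mn i) × ι) (Idx (Mn i) × ι) ℝ) (Pc : ∀ i, (Bc i).Cfg → Matrix (Idx (Mn i) × ι) (Idx (Mn i) × ι) ℝ) (c c' : I → ι) (i : I)
    (U : (Bf i).Cfg) (y y' : Tor (Mn i)) :
    (cSiteExOn ι Mn kk mm Msz X blk gf Bc Bf aS pair Pf Pc c c' i).ker U y y' =
      siteExC ι (L ^ mm i * L ^ kk i) (aK aS L (kk i + mm i)) (Mn i) (Pf i U) (torIdx (Mn i) y, c i) (torIdx (Mn i) y', c' i)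
        - siteExC ι (L ^ kk i) (aK aS L (kk i)) (Mn i) (Pc i ((pair i).avg U)) (torIdx (Mn i) y, c i) (torIdx (Mn i) y', c' i) := rfl
set_option maxHeartbeats 400000 in
/-- ★★★ **THE COLOURED SITE SOCKET — `NE2PlusSite` BY NAME, EVERY COLOUR ENTRY, FROM THE COLOURED PERTURBATIONS' THREE LETTERS ALONE, SIZE LIVE.**  Odd `L ≥ 3`, `a_S > 0`, `c₃₅`,
exponents `(d′, p)`; a family `pi i = ⟨opGeo (unitTorusGeoS L (k i) (M i) (M_sz i)) (X i) (blk i), gf i, Bc i, Bf i, pair i⟩` on the tori of record `M i = 2L^{m_T i}`, `k i ≥ 1`, `(gf i).M ≥ 1`;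
`γ_P > 0`; coloured site perturbations `Pf`, `Pc` on `Idx (M i) × ι` with part II's THREE LETTERS READ AT SIZE (`|Pc i (avg U)|, |Pf i U| ≤ ζ(M·α₀)e^{−δ_P·tdist}` in the SITE distance,
uniform in colour, `|Pf i U − Pc i (avg U)| ≤ τ(L^{k i})^{−γ_P}e^{−δ_P·tdist}` under `Reg335 c₃₅ α₀ U`, `M·α₀ ≤ a₁`) ⟹ for EVERY colour selector pair `(c, c′)`,
`NE2PlusSite d′ p c₃₅ pi (cSiteExOn … c c′)`; constants `(1, κ₁∕2, min a₁ (γ₀∕(4ζV₁)), (4∕γ₀)(C_r + τ)(4∕γ₀)V₂², min ¼ γ_P)` with `V₁, V₂` the coloured row sums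
`|ι|·K_{d+1}(·) + 1` — part XI §1's proof on the index `Idx M × ι` (engine `abs_inv_add_sub_inv_add_le_of_coercive` with `ρ = tdist ∘ (fst, fst)`, `coercive_colDiag`, `colDiag_decay`).
[cite: Balaban1985BackgroundPropagators, Thm 3.2 (3.48) p.398 + Thm 3.14 pp.426–427 (quantifier template: «for M ≥ M₁», «Mα₀ small»), (3.65)–(3.67) p.403 (mechanism); Balaban1984PropagatorsI, (1.45) p.26; King1986, Prop. 3.8 (3.71) p.664, (4.40)–(4.41) pp.674–675; CombesThomas1973, §II] -/
theorem ne2PlusSite_cSiteExOn_of_sizedLetters (hLodd : Odd L) (hL2 : 2 ≤ L) {aS : ℝ} (haS : 0 < aS) (c35 : ℝ) (d' : ℕ) (p : ℝ)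
    {mT : I → ℕ} (hMnT : ∀ i μ, Mn i μ = 2 * L ^ mT i) (hk : ∀ i, 1 ≤ kk i) (hM : ∀ i, 1 ≤ (gf i).M)
    (pair : ∀ i, EtaPairing (opGeo (unitTorusGeoS L (kk i) (Mn i) (Msz i)) (X i) (blk i)) (gf i) (Bc i) (Bf i))
    (Pf : ∀ i, (Bf i).Cfg → Matrix (Idx (Mn i) × ι) (Idx (Mn i) × ι) ℝ) (Pc : ∀ i, (Bc i).Cfg → Matrix (Idx (Mn i) × ι) (Idx (Mn i) × ι) ℝ) {γP : ℝ} (hγP : 0 < γP)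
    (hP : ∃ δP ζ τ a₁ : ℝ, 0 < δP ∧ 0 < ζ ∧ 0 < τ ∧ 0 < a₁ ∧
      ∀ (i : I) (α₀ : ℝ), 0 < α₀ → (gf i).M * α₀ ≤ a₁ → ∀ U : (Bf i).Cfg, (Bf i).Reg335 c35 α₀ U →
        (∀ p q : Idx (Mn i) × ι, |Pc i ((pair i).avg U) p q| ≤ ζ * ((gf i).M * α₀) * Real.exp (-(δP * tdist (Mn i) p.1 q.1))) ∧
        (∀ p q : Idx (Mn i) × ι, |Pf i U p q| ≤ ζ * ((gf i).M * α₀) * Real.exp (-(δP * tdist (Mn i) p.1 q.1))) ∧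
        (∀ p q : Idx (Mn i) × ι, |Pf i U p q - Pc i ((pair i).avg U) p q| ≤ τ * ((L : ℝ) ^ kk i) ^ (-γP) * Real.exp (-(δP * tdist (Mn i) p.1 q.1))))
    (c c' : I → ι) :
    NE2PlusSite d' p c35 (fun i => (⟨opGeo (unitTorusGeoS L (kk i) (Mn i) (Msz i)) (X i) (blk i), gf i, Bc i, Bf i, pair i⟩ : PairedInstance))
      (cSiteExOn ι Mn kk mm Msz X blk gf Bc Bf aS pair Pf Pc c c') := by
  obtain ⟨γ₀, c₀, δ, Cr, hγ₀, hc₀, hδ, hCr, HF⟩ := siteForm_letters_family (d := d) hLodd hL2 haS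
  obtain ⟨δP, ζ, τ, a₁, hδP, hζ, hτ, ha₁, HP⟩ := hP
  have hL0 : 0 < L := by omega
  have hLr : (1 : ℝ) < L := by exact_mod_cast (show 1 < L by omega)
  have hLR : (1 : ℝ) ≤ L := hLr.le
  have hcard : (0 : ℝ) ≤ (Fintype.card ι : ℝ) := Nat.cast_nonneg _
  -- the common rate, the COLOURED torus sums (factor `|ι|`), the Combes–Thomas rate, the threshold (as in part II ∕ part XI §1)
  obtain ⟨κ, hκdef⟩ : ∃ κ : ℝ, κ = min δ δP := ⟨_, rfl⟩
  have hκ : 0 < κ := hκdef ▸ lt_min hδ hδP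
  have hκδ : κ ≤ δ := hκdef ▸ min_le_left _ _
  have hκP : κ ≤ δP := hκdef ▸ min_le_right _ _
  obtain ⟨V₁, hV₁def⟩ : ∃ V₁ : ℝ, V₁ = (Fintype.card ι : ℝ) * latticeConst (d + 1) (κ / 4) + 1 := ⟨_, rfl⟩
  have hV₁1 : 1 ≤ V₁ := by rw [hV₁def]; nlinarith [latticeConst_nonneg (d + 1) (show 0 ≤ κ / 4 by positivity)]
  have hV₁0 : 0 < V₁ := by linarith
  obtain ⟨κ₁, hκ₁def⟩ : ∃ κ₁ : ℝ, κ₁ = min (κ / 4) (γ₀ * κ / (8 * (c₀ + ζ * a₁) * V₁)) := ⟨_, rfl⟩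
  have hden : 0 < 8 * (c₀ + ζ * a₁) * V₁ := by positivity
  have hκ₁ : 0 < κ₁ := hκ₁def ▸ lt_min (by positivity) (div_pos (by positivity) hden)
  have hκ₁κ : κ₁ ≤ κ / 4 := hκ₁def ▸ min_le_left _ _
  have hκ₁s : 8 * (c₀ + ζ * a₁) * V₁ * κ₁ ≤ γ₀ * κ := by
    have h1 : κ₁ ≤ γ₀ * κ / (8 * (c₀ + ζ * a₁) * V₁) := hκ₁def ▸ min_le_right _ _
    have h2 := mul_le_mul_of_nonneg_left h1 hden.le
    rwa [mul_div_cancel₀ _ hden.ne'] at h2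
  obtain ⟨V₂, hV₂def⟩ : ∃ V₂ : ℝ, V₂ = (Fintype.card ι : ℝ) * latticeConst (d + 1) (κ₁ / 2) + 1 := ⟨_, rfl⟩
  have hV₂0 : 0 < V₂ := by rw [hV₂def]; nlinarith [latticeConst_nonneg (d + 1) (show 0 ≤ κ₁ / 2 by positivity)]
  obtain ⟨a₀, ha₀def⟩ : ∃ a₀ : ℝ, a₀ = min a₁ (γ₀ / (4 * ζ * V₁)) := ⟨_, rfl⟩
  have ha₀ : 0 < a₀ := ha₀def ▸ lt_min ha₁ (div_pos hγ₀ (by positivity))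
  obtain ⟨γo, hγodef⟩ : ∃ γo : ℝ, γo = min (1 / 4) γP := ⟨_, rfl⟩
  have hγo : 0 < γo := hγodef ▸ lt_min (by norm_num) hγP
  have hγo4 : γo ≤ 1 / 4 := hγodef ▸ min_le_left _ _
  have hγoP : γo ≤ γP := hγodef ▸ min_le_right _ _
  refine ⟨1, κ₁ / 2, a₀, 4 / γ₀ * (Cr + τ) * (4 / γ₀) * V₂ ^ 2, γo, one_pos, half_pos hκ₁, ha₀, by positivity, hγo, fun i _ α₀ hα₀ hMα U hreg => ?_⟩
  -- this index: the smallness parameter is `s := M·α₀`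
  set s : ℝ := (gf i).M * α₀ with hsdef
  have hs0 : 0 < s := mul_pos (lt_of_lt_of_le one_pos (hM i)) hα₀
  have hαa₀ : s ≤ a₀ := hMα
  have hαa₁ : s ≤ a₁ := hαa₀.trans (ha₀def ▸ min_le_left _ _)
  have hM1 : ∀ μ, 1 ≤ Mn i μ := fun μ => Nat.one_le_iff_ne_zero.mpr (NeZero.ne _)
  obtain ⟨hcoK, hcoK', hK, hK', hKK⟩ := HF (mT i) (kk i) (mm i) (hk i) (Mn i) (hMnT i)
  obtain ⟨hPc, hPf, hPfc⟩ := HP i α₀ hα₀ hαa₁ U hreg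
  -- the lifted distance `ρ((p,i),(q,j)) = tdist(p,q)` and its letters
  have hρ : ∀ p q : Idx (Mn i) × ι, 0 ≤ tdist (Mn i) p.1 q.1 := fun p q => tdist_nonneg _ _ _
  have hρs : ∀ p q : Idx (Mn i) × ι, tdist (Mn i) p.1 q.1 = tdist (Mn i) q.1 p.1 := fun p q => tdist_symm hM1 _ _
  have hρ0 : ∀ p : Idx (Mn i) × ι, tdist (Mn i) p.1 p.1 = 0 := fun p => tdist_self _ _
  have hρt : ∀ p q r : Idx (Mn i) × ι, tdist (Mn i) p.1 r.1 ≤ tdist (Mn i) p.1 q.1 + tdist (Mn i) q.1 r.1 := fun p q r => tdist_triangle hM1 _ _ _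
  have hV₁ : ∀ p : Idx (Mn i) × ι, ∑ q : Idx (Mn i) × ι, Real.exp (-(κ / 4 * tdist (Mn i) p.1 q.1)) ≤ V₁ := fun p =>
    (colRowSum_le ι (tdist (Mn i)) (fun p₁ => torusSum_le (d + 1) hM1 (by positivity) p₁) p).trans (by rw [hV₁def]; linarith)
  have hV₂ : ∀ p : Idx (Mn i) × ι, ∑ q : Idx (Mn i) × ι, Real.exp (-(κ₁ / 2 * tdist (Mn i) p.1 q.1)) ≤ V₂ := fun p =>
    (colRowSum_le ι (tdist (Mn i)) (fun p₁ => torusSum_le (d + 1) hM1 (by positivity) p₁) p).trans (by rw [hV₂def]; linarith)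
  have hLk1 : (1 : ℝ) ≤ (L : ℝ) ^ kk i := one_le_pow₀ hLR
  have hr4 : ((L : ℝ) ^ kk i) ^ (-(1 / 4 : ℝ)) ≤ ((L : ℝ) ^ kk i) ^ (-γo) := Real.rpow_le_rpow_of_exponent_le hLk1 (by linarith)
  have hrP : ((L : ℝ) ^ kk i) ^ (-γP) ≤ ((L : ℝ) ^ kk i) ^ (-γo) := Real.rpow_le_rpow_of_exponent_le hLk1 (by linarith)
  have hro : 0 ≤ ((L : ℝ) ^ kk i) ^ (-γo) := Real.rpow_nonneg (by positivity) _
  -- the lifted `U ≡ 1` letters (colour-diagonal) at the common rate `κ`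
  have hK₁ : ∀ p q : Idx (Mn i) × ι, |colDiag ι (qggqRe (L ^ kk i) (aK aS L (kk i)) (Mn i)) p q| ≤ c₀ * Real.exp (-(κ * tdist (Mn i) p.1 q.1)) :=
    fun p q => (colDiag_decay ι (tdist (Mn i)) hK p q).trans (exp_decay_mono hc₀.le hκδ (hρ p q))
  have hK₁' : ∀ p q : Idx (Mn i) × ι, |colDiag ι (qggqRe (L ^ mm i * L ^ kk i) (aK aS L (kk i + mm i)) (Mn i)) p q| ≤ c₀ * Real.exp (-(κ * tdist (Mn i) p.1 q.1)) :=
    fun p q => (colDiag_decay ι (tdist (Mn i)) hK' p q).trans (exp_decay_mono hc₀.le hκδ (hρ p q))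
  have hKK₁ : ∀ p q : Idx (Mn i) × ι, |colDiag ι (qggqRe (L ^ mm i * L ^ kk i) (aK aS L (kk i + mm i)) (Mn i)) p q - colDiag ι (qggqRe (L ^ kk i) (aK aS L (kk i)) (Mn i)) p q|
      ≤ Cr * ((L : ℝ) ^ kk i) ^ (-γo) * Real.exp (-(κ * tdist (Mn i) p.1 q.1)) := fun p q => by
    rw [← Matrix.sub_apply, ← colDiag_sub]
    exact (colDiag_decay ι (tdist (Mn i)) hKK p q).trans ((mul_le_mul_of_nonneg_right (mul_le_mul_of_nonneg_left hr4 hCr.le) (Real.exp_nonneg _)).trans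
      (exp_decay_mono (mul_nonneg hCr.le hro) hκδ (hρ p q)))
  have hPc₁ : ∀ p q : Idx (Mn i) × ι, |Pc i ((pair i).avg U) p q| ≤ ζ * s * Real.exp (-(κ * tdist (Mn i) p.1 q.1)) :=
    fun p q => (hPc p q).trans (exp_decay_mono (by positivity) hκP (hρ p q))
  have hPf₁ : ∀ p q : Idx (Mn i) × ι, |Pf i U p q| ≤ ζ * s * Real.exp (-(κ * tdist (Mn i) p.1 q.1)) :=
    fun p q => (hPf p q).trans (exp_decay_mono (by positivity) hκP (hρ p q))
  have hPP₁ : ∀ p q : Idx (Mn i) × ι, |Pf i U p q - Pc i ((pair i).avg U) p q| ≤ τ * ((L : ℝ) ^ kk i) ^ (-γo) * Real.exp (-(κ * tdist (Mn i) p.1 q.1)) := fun p q =>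
    (hPfc p q).trans ((mul_le_mul_of_nonneg_right (mul_le_mul_of_nonneg_left hrP hτ.le) (Real.exp_nonneg _)).trans
      (exp_decay_mono (mul_nonneg hτ.le hro) hκP (hρ p q)))
  have hs₁ : ζ * s * V₁ ≤ γ₀ / 2 := by
    have h1 : s ≤ γ₀ / (4 * ζ * V₁) := hαa₀.trans (ha₀def ▸ min_le_right _ _)
    have h2 := mul_le_mul_of_nonneg_left h1 (show 0 ≤ 4 * ζ * V₁ by positivity)
    rw [mul_div_cancel₀ _ (by positivity : (4 * ζ * V₁ : ℝ) ≠ 0)] at h2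
    nlinarith
  have hs₂ : 8 * (c₀ + ζ * s) * V₁ * κ₁ ≤ γ₀ * κ := by
    have h1 : 8 * (c₀ + ζ * s) * V₁ * κ₁ ≤ 8 * (c₀ + ζ * a₁) * V₁ * κ₁ := by
      have := mul_le_mul_of_nonneg_left hαa₁ hζ.le
      have hVκ : 0 ≤ V₁ * κ₁ := by positivity
      nlinarith
    exact h1.trans hκ₁s
  have h := abs_inv_add_sub_inv_add_le_of_coercive (fun p q : Idx (Mn i) × ι => tdist (Mn i) p.1 q.1) hρ hρs hρ0 hρt hγ₀ hc₀.le (by positivity : 0 ≤ ζ * s)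
    (by positivity : 0 ≤ Cr * ((L : ℝ) ^ kk i) ^ (-γo)) (by positivity : 0 ≤ τ * ((L : ℝ) ^ kk i) ^ (-γo)) hκ hκ₁.le hκ₁κ
    (coercive_colDiag ι hcoK) (coercive_colDiag ι hcoK') hK₁ hK₁' hPc₁ hPf₁ hKK₁ hPP₁ hV₁ hV₂ hs₁ hs₂
  -- the unit-site readout (G1) over the general carrier: `len ≡ 1`, rate factor `(L^k)^{−γo}`, at the colour entry `(c i, c′ i)`
  have hLne : (L : ℝ) ≠ 0 := by exact_mod_cast (NeZero.ne L)
  have hLpos : (0 : ℝ) < (L : ℝ) := by exact_mod_cast hL0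
  have hlen : ∀ y : (unitTorusGeoS L (kk i) (Mn i) (Msz i)).Site, (unitTorusGeoS L (kk i) (Mn i) (Msz i)).len y = 1 := fun y => by
    show (L : ℝ) ^ kk i * ((L : ℝ) ^ kk i)⁻¹ = 1
    exact mul_inv_cancel₀ (pow_ne_zero _ hLne)
  have hη : (unitTorusGeoS L (kk i) (Mn i) (Msz i)).eta ≠ 0 := inv_ne_zero (pow_ne_zero _ hLpos.ne')
  refine etaRateIneqSite_opGeo_unit (g := unitTorusGeoS L (kk i) (Mn i) (Msz i)) (B := Bf i) (cSiteExOn ι Mn kk mm Msz X blk gf Bc Bf aS pair Pf Pc c c' i)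
    hlen hη hLpos (fun y y' => ?_) d' p
  have hyy := h (torIdx (Mn i) y, c i) (torIdx (Mn i) y', c' i)
  simp only at hyy
  rw [← tdistT_eq_tdist_torIdx] at hyy
  show |siteExC ι (L ^ mm i * L ^ kk i) (aK aS L (kk i + mm i)) (Mn i) (Pf i U) (torIdx (Mn i) y, c i) (torIdx (Mn i) y', c' i)
        - siteExC ι (L ^ kk i) (aK aS L (kk i)) (Mn i) (Pc i ((pair i).avg U)) (torIdx (Mn i) y, c i) (torIdx (Mn i) y', c' i)|
      ≤ 4 / γ₀ * (Cr + τ) * (4 / γ₀) * V₂ ^ 2 * Real.exp (-(κ₁ / 2 * tdistT (Mn i) y y')) * max (((L : ℝ) ^ kk i) ^ (-γo)) (((L : ℝ) ^ kk i) ^ (-γo))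
  rw [max_self]
  unfold siteExC
  refine hyy.trans (le_of_eq ?_)
  ring

end Socket

end Summit.QuantumFields.YangMills.BalabanUVNodes.N15.SiteLayerBg

end
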